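import Mathlib
import HarnessLib
import Literature.NumberTheory.Sieve.BatemanHorn

/-!
# Disc majorant from the smooth/rough resummation (stub `stub_majorant_of_smooth_rough`)

Line `smooth-rough-lattice-acquisition` of crux stmt-Parity-11291
(`Summit.Parity.BatemanHorn.Theses.AlmostPrimeZeros.SystemZeroRepulsion`), stub S7.

Notation: `S_x(z) = Σ_{n ≤ x} z^{s_f(n)}`, `L = log log x`, `L₃ = log L`, `U = log x / L₃`,
`r = ‖z − 1‖`, `ℓ = log (r + 2)`, `a = k (Re z − 1)`, `R = Σ_{m₀ ≤ n ≤ x} z^{s♯_x(n)}` (rough sum),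
`CS_q` the rough class sum of the class `q = (d, a)`.  The three hypotheses are the smooth
factorisation S4 (`‖S − Σ_q c_q CS_q‖ ≤ x (log x)^a`, `‖Σ_q c_q/d_q‖ ≤ A₄ L₃^a e^{C₄ r ℓ}`,
`Σ_q ‖c_q‖/d_q ≤ L₃^{k(‖z‖−1)} e^{C₄(‖z‖+1)}`), the rough equidistribution S5
(`‖CS_q − R/d_q‖ ≤ (x/d_q) U^a e^{C₅ r ℓ} (log x)^{−δ}`) and the rough majorant S6
(`‖R‖ ≤ A₆ x U^a e^{C₆ r ℓ}`).  The conclusion is the one-sided disc majorant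
`‖S_x(z)‖ ≤ A x (log x)^a e^{C r^{3/2}}` on `r ≤ 3L`, for `x ≥ x₀(f)`.

Proof (pure resummation, no number theory).  Writing
`Σ_q c_q CS_q = (Σ_q c_q/d_q) R + Σ_q c_q (CS_q − R/d_q)`,
`‖S‖ ≤ x (log x)^a + ‖Σ_q c_q/d_q‖ ‖R‖ + (Σ_q ‖c_q‖/d_q) · x U^a e^{C₅ r ℓ} (log x)^{−δ}`.
With `U^a L₃^a = (log x)^a`, `L₃^{k(‖z‖−1)} U^a = (log x)^a L₃^{k(‖z‖ − Re z)}`,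
`0 ≤ ‖z‖ − Re z ≤ 2r` and `(log x)^{−δ} = e^{−δ L}` the three terms are `x (log x)^a` times
`1`, `A₄A₆ e^{(C₄+C₆) r ℓ}` and `exp (2 k r log L₃ + C₄ (r+2) + C₅ r ℓ − δ L)`.  Finally
`r ℓ ≤ 3 r^{3/2} + 1`, `α r ≤ r^{3/2} + α³` (`α = 2k log L₃ ≥ 0` once `L₃ ≥ 1`) and
`8 k³ (log L₃)³ ≤ 48 k³ L₃ ≤ 96 k³ √L ≤ δ L` once `L ≥ (96 k³/δ)²`; so every exponent is
`≤ 6P r^{3/2} + 4P` with `P = 1 + C₄⁺ + C₅⁺ + C₆⁺`, whence `C = 6P` and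
`A = 1 + (1 + A₄⁺A₆⁺) e^{4P}`, valid for `x ≥ exp exp (max e (96k³/δ)²)` and `x ≥ x₀` of S4–S6.
-/

noncomputable section

namespace Summit.Parity.BatemanHorn.Cruxes.SystemZeroRepulsion.SmoothRoughLatticeAcquisition

/-! ### Elementary real inequalities -/

/-- `log (r + 2) ≤ 2 √r + 1` for `r ≥ 0`: `log (r+2) = 2 log √(r+2) ≤ 2 (√(r+2) − 1)` and
`√(r+2) ≤ √r + 3/2`. -/
private theorem log_add_two_le {r : ℝ} (hr : 0 ≤ r) : Real.log (r + 2) ≤ 2 * Real.sqrt r + 1 := by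
  have h2 : (0 : ℝ) < r + 2 := by linarith
  have h1 : Real.log (r + 2) = 2 * Real.log (Real.sqrt (r + 2)) := by
    rw [Real.log_sqrt h2.le]; ring
  have h3 : Real.log (Real.sqrt (r + 2)) ≤ Real.sqrt (r + 2) - 1 :=
    Real.log_le_sub_one_of_pos (Real.sqrt_pos.2 h2)
  have h4 : Real.sqrt (r + 2) ≤ Real.sqrt r + 3 / 2 := by
    rw [Real.sqrt_le_left (by positivity)]
    nlinarith [Real.sq_sqrt hr, Real.sqrt_nonneg r]
  linarith

/-- `α r ≤ r √r + α³` for `α, r ≥ 0` (cases `α ≤ √r`, and `√r < α` giving `r < α²`). -/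
private theorem mul_le_mul_sqrt_add_cube {α r : ℝ} (hα : 0 ≤ α) (hr : 0 ≤ r) :
    α * r ≤ r * Real.sqrt r + α ^ 3 := by
  rcases le_or_gt α (Real.sqrt r) with h | h
  · have h1 : α * r ≤ Real.sqrt r * r := mul_le_mul_of_nonneg_right h hr
    nlinarith [pow_nonneg hα 3]
  · have hα' : 0 < α := (Real.sqrt_nonneg r).trans_lt h
    have h1 : r < α ^ 2 := (Real.sqrt_lt' hα').1 h
    have h2 : α * r ≤ α ^ 3 :=
      calc α * r ≤ α * α ^ 2 := mul_le_mul_of_nonneg_left h1.le hα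
        _ = α ^ 3 := by ring
    linarith [mul_nonneg hr (Real.sqrt_nonneg r)]

/-- `r log (r + 2) ≤ 3 r √r + 1` for `r ≥ 0`. -/
private theorem mul_log_le {r : ℝ} (hr : 0 ≤ r) :
    r * Real.log (r + 2) ≤ 3 * (r * Real.sqrt r) + 1 := by
  have h1 : r * Real.log (r + 2) ≤ r * (2 * Real.sqrt r + 1) :=
    mul_le_mul_of_nonneg_left (log_add_two_le hr) hr
  have h2 := mul_le_mul_sqrt_add_cube zero_le_one hr
  linarith

/-- The `x`-dependent price of the absolute resummation is affordable:
for `L ≥ e` and `L ≥ (96 k³/δ)²`, `8 k³ (log log L)³ ≤ δ L`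
(`u³ ≤ 6 e^u` gives `(log log L)³ ≤ 6 log L`, and `log L ≤ 2 √L`). -/
private theorem cube_logloglog_le {k : ℕ} {δ L : ℝ} (hδ : 0 < δ) (hLe : Real.exp 1 ≤ L)
    (hLM : (96 * (k : ℝ) ^ 3 / δ) ^ 2 ≤ L) :
    8 * (k : ℝ) ^ 3 * Real.log (Real.log L) ^ 3 ≤ δ * L := by
  have hL : 0 < L := (Real.exp_pos 1).trans_le hLe
  have hL₃ : 1 ≤ Real.log L := by rw [Real.le_log_iff_exp_le hL]; exact hLe
  have hL₃pos : 0 < Real.log L := by linarith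
  have h1 : Real.log (Real.log L) ^ 3 ≤ 6 * Real.log L := by
    have h := Real.pow_div_factorial_le_exp _ (Real.log_nonneg hL₃) 3
    rw [Real.exp_log hL₃pos] at h
    have h6 : ((Nat.factorial 3 : ℕ) : ℝ) = 6 := by norm_num [Nat.factorial]
    rw [h6, div_le_iff₀ (by norm_num : (0 : ℝ) < 6)] at h
    linarith
  have h2 : Real.log L ≤ 2 * Real.sqrt L := by
    have e1 : Real.log L = 2 * Real.log (Real.sqrt L) := by rw [Real.log_sqrt hL.le]; ring
    have e2 := Real.log_le_sub_one_of_pos (Real.sqrt_pos.2 hL)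
    linarith
  have hM : 96 * (k : ℝ) ^ 3 / δ ≤ Real.sqrt L := Real.le_sqrt_of_sq_le hLM
  have hM' : 96 * (k : ℝ) ^ 3 ≤ δ * Real.sqrt L := by
    rw [div_le_iff₀ hδ] at hM; linarith
  calc 8 * (k : ℝ) ^ 3 * Real.log (Real.log L) ^ 3
      ≤ 8 * (k : ℝ) ^ 3 * (6 * (2 * Real.sqrt L)) := by
        gcongr; exact h1.trans (by linarith)
    _ = Real.sqrt L * (96 * (k : ℝ) ^ 3) := by ring
    _ ≤ Real.sqrt L * (δ * Real.sqrt L) := mul_le_mul_of_nonneg_left hM' (Real.sqrt_nonneg L)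
    _ = δ * L := by rw [mul_left_comm, Real.mul_self_sqrt hL.le]

/-! ### The resummation identity -/

/-- Triangle inequality behind the resummation: with `d_q = q.1`,
`S = (S − Σ_q c_q CS_q) + (Σ_q c_q/d_q) R + Σ_q c_q (CS_q − R/d_q)`. -/
private theorem norm_le_resum (ι : Finset (ℕ × ℕ)) (c CS : ℕ × ℕ → ℂ) (S R : ℂ) :
    ‖S‖ ≤ ‖S - ∑ q ∈ ι, c q * CS q‖ + ‖∑ q ∈ ι, c q / (q.1 : ℂ)‖ * ‖R‖ +
      ∑ q ∈ ι, ‖c q‖ * ‖CS q - R / (q.1 : ℂ)‖ := by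
  have h : ∑ q ∈ ι, (c q / (q.1 : ℂ) * R + c q * (CS q - R / (q.1 : ℂ))) = ∑ q ∈ ι, c q * CS q :=
    Finset.sum_congr rfl fun q _ => by ring
  have key : (S - ∑ q ∈ ι, c q * CS q) + (∑ q ∈ ι, c q / (q.1 : ℂ)) * R +
      ∑ q ∈ ι, c q * (CS q - R / (q.1 : ℂ)) = S := by
    rw [add_assoc, Finset.sum_mul, ← Finset.sum_add_distrib, h, sub_add_cancel]
  have hsum : ‖∑ q ∈ ι, c q * (CS q - R / (q.1 : ℂ))‖ ≤ ∑ q ∈ ι, ‖c q‖ * ‖CS q - R / (q.1 : ℂ)‖ :=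
    (norm_sum_le _ _).trans_eq (Finset.sum_congr rfl fun q _ => norm_mul _ _)
  calc ‖S‖ = ‖(S - ∑ q ∈ ι, c q * CS q) + (∑ q ∈ ι, c q / (q.1 : ℂ)) * R +
      ∑ q ∈ ι, c q * (CS q - R / (q.1 : ℂ))‖ := by rw [key]
    _ ≤ ‖S - ∑ q ∈ ι, c q * CS q‖ + ‖(∑ q ∈ ι, c q / (q.1 : ℂ)) * R‖ +
      ‖∑ q ∈ ι, c q * (CS q - R / (q.1 : ℂ))‖ := norm_add₃_le
    _ ≤ _ := by rw [norm_mul]; exact add_le_add_right hsum _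

/-! ### The analytic core -/

/-- The resummation with abstract inputs: from (E), (Λ), (B) of S4, the rough majorant S6 and the
rough equidistribution S5 on the classes of `ι`, for `log x ≥ exp (max e (96k³/δ)²)` (here `lx`
stands for `log x` and `L₃ = log log lx`), the disc majorant with `C = 6P` and
`A = 1 + (1 + B₄ B₆) e^{4P}` whenever `1, C₄, C₅, C₆ ≤ P`, `A₄ ≤ B₄`, `A₆ ≤ B₆`, `0 ≤ B₄, B₆`. -/
private theorem majorant_core {k : ℕ} {x lx L₃ A₄ B₄ C₄ δ C₅ A₆ B₆ C₆ P : ℝ} {z S R : ℂ}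
    {ι : Finset (ℕ × ℕ)} {c CS : ℕ × ℕ → ℂ} (hδ : 0 < δ) (hP : 1 ≤ P) (hC₄ : C₄ ≤ P)
    (hC₅ : C₅ ≤ P) (hC₆ : C₆ ≤ P) (hA₄ : A₄ ≤ B₄) (hA₆ : A₆ ≤ B₆) (hB₄ : 0 ≤ B₄) (hB₆ : 0 ≤ B₆)
    (hx : 0 ≤ x)
    (hE : ‖S - ∑ q ∈ ι, c q * CS q‖ ≤ x * lx ^ ((k : ℝ) * (z.re - 1)))
    (hΛ : ‖∑ q ∈ ι, c q / (q.1 : ℂ)‖ ≤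
      A₄ * L₃ ^ ((k : ℝ) * (z.re - 1)) * Real.exp (C₄ * ‖z - 1‖ * Real.log (‖z - 1‖ + 2)))
    (hB : ∑ q ∈ ι, ‖c q‖ / (q.1 : ℝ) ≤ L₃ ^ ((k : ℝ) * (‖z‖ - 1)) * Real.exp (C₄ * (‖z‖ + 1)))
    (h6 : ‖R‖ ≤ A₆ * x * (lx / L₃) ^ ((k : ℝ) * (z.re - 1)) *
      Real.exp (C₆ * ‖z - 1‖ * Real.log (‖z - 1‖ + 2)))
    (h5 : ∀ q ∈ ι, ‖CS q - R / (q.1 : ℂ)‖ ≤ x / (q.1 : ℝ) * (lx / L₃) ^ ((k : ℝ) * (z.re - 1)) *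
      Real.exp (C₅ * ‖z - 1‖ * Real.log (‖z - 1‖ + 2)) * lx ^ (-δ))
    (hlx : Real.exp (max (Real.exp 1) ((96 * (k : ℝ) ^ 3 / δ) ^ 2)) ≤ lx)
    (hL₃ : L₃ = Real.log (Real.log lx)) :
    ‖S‖ ≤ (1 + (1 + B₄ * B₆) * Real.exp (4 * P)) * x * lx ^ ((k : ℝ) * (z.re - 1)) *
      Real.exp (6 * P * ‖z - 1‖ ^ (3 / 2 : ℝ)) := by
  -- thresholds
  have hlx0 : 0 < lx := (Real.exp_pos _).trans_le hlx
  have hLT : max (Real.exp 1) ((96 * (k : ℝ) ^ 3 / δ) ^ 2) ≤ Real.log lx :=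
    (Real.le_log_iff_exp_le hlx0).2 hlx
  have hLe : Real.exp 1 ≤ Real.log lx := (le_max_left _ _).trans hLT
  have hL0 : 0 < Real.log lx := (Real.exp_pos 1).trans_le hLe
  have hL₃1 : 1 ≤ L₃ := by rw [hL₃, Real.le_log_iff_exp_le hL0]; exact hLe
  have hL₃0 : 0 < L₃ := by linarith
  have hL₄0 : 0 ≤ Real.log L₃ := Real.log_nonneg hL₃1
  have hcube : 8 * (k : ℝ) ^ 3 * Real.log L₃ ^ 3 ≤ δ * Real.log lx := by
    rw [hL₃]; exact cube_logloglog_le hδ hLe ((le_max_right _ _).trans hLT)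
  -- geometry of `z`
  have hr0 : 0 ≤ ‖z - 1‖ := norm_nonneg _
  have hnz : ‖z‖ ≤ ‖z - 1‖ + 1 := by
    have h := norm_le_norm_add_norm_sub' z 1
    rw [norm_one] at h
    linarith
  have hre : 1 - ‖z - 1‖ ≤ z.re := by
    have h := Complex.abs_re_le_norm (z - 1)
    rw [Complex.sub_re, Complex.one_re] at h
    linarith [(abs_le.1 h).1]
  generalize ‖z - 1‖ = r at hr0 hnz hre hΛ h6 h5 ⊢
  -- elementary bounds in terms of `r √r = r ^ (3/2)`
  have hρ : r ^ (3 / 2 : ℝ) = r * Real.sqrt r := by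
    rw [show (3 / 2 : ℝ) = 1 + 1 / 2 by norm_num, Real.rpow_add' hr0 (by norm_num : (1 : ℝ) + 1 / 2 ≠ 0),
      Real.rpow_one, Real.sqrt_eq_rpow]
  rw [hρ]
  have hρ0 : 0 ≤ r * Real.sqrt r := mul_nonneg hr0 (Real.sqrt_nonneg r)
  have hℓ0 : 0 ≤ Real.log (r + 2) := Real.log_nonneg (by linarith)
  have hrℓ0 : 0 ≤ r * Real.log (r + 2) := mul_nonneg hr0 hℓ0
  have hrℓ : r * Real.log (r + 2) ≤ 3 * (r * Real.sqrt r) + 1 := mul_log_le hr0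
  have hr1 : r ≤ r * Real.sqrt r + 1 := by
    have := mul_le_mul_sqrt_add_cube zero_le_one hr0; linarith
  have hkey : Real.log L₃ * ((k : ℝ) * (‖z‖ - z.re)) ≤ r * Real.sqrt r + δ * Real.log lx := by
    have h1 : (k : ℝ) * (‖z‖ - z.re) ≤ k * (2 * r) :=
      mul_le_mul_of_nonneg_left (by linarith) (Nat.cast_nonneg k)
    have h2 := mul_le_mul_of_nonneg_left h1 hL₄0
    have h3 := mul_le_mul_sqrt_add_cube
      (mul_nonneg (by positivity) hL₄0 : (0 : ℝ) ≤ 2 * k * Real.log L₃) hr0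
    have h4 : (2 * (k : ℝ) * Real.log L₃) ^ 3 = 8 * (k : ℝ) ^ 3 * Real.log L₃ ^ 3 := by ring
    linarith
  -- the two exponents
  have hE₂ : Real.log L₃ * ((k : ℝ) * (‖z‖ - z.re)) + C₄ * (‖z‖ + 1) + C₅ * r * Real.log (r + 2) +
      Real.log lx * (-δ) ≤ 6 * P * (r * Real.sqrt r) + 4 * P := by
    have h1 : C₄ * (‖z‖ + 1) ≤ P * (r + 2) :=
      (mul_le_mul_of_nonneg_right hC₄ (by positivity)).trans
        (mul_le_mul_of_nonneg_left (by linarith) (by linarith))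
    have h2 : C₅ * r * Real.log (r + 2) ≤ P * (r * Real.log (r + 2)) := by
      rw [mul_assoc]; exact mul_le_mul_of_nonneg_right hC₅ hrℓ0
    have h3 : P * (r * Real.log (r + 2)) ≤ P * (3 * (r * Real.sqrt r) + 1) :=
      mul_le_mul_of_nonneg_left hrℓ (by linarith)
    have h4 : P * (r + 2) ≤ P * (r * Real.sqrt r + 3) :=
      mul_le_mul_of_nonneg_left (by linarith) (by linarith)
    have h5 : r * Real.sqrt r ≤ P * (r * Real.sqrt r) := le_mul_of_one_le_left hρ0 hP
    linarith
  have hE₃ : C₄ * r * Real.log (r + 2) + C₆ * r * Real.log (r + 2) ≤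
      6 * P * (r * Real.sqrt r) + 4 * P := by
    have h1 : C₄ * r * Real.log (r + 2) ≤ P * (r * Real.log (r + 2)) := by
      rw [mul_assoc]; exact mul_le_mul_of_nonneg_right hC₄ hrℓ0
    have h2 : C₆ * r * Real.log (r + 2) ≤ P * (r * Real.log (r + 2)) := by
      rw [mul_assoc]; exact mul_le_mul_of_nonneg_right hC₆ hrℓ0
    have h3 : P * (r * Real.log (r + 2)) ≤ P * (3 * (r * Real.sqrt r) + 1) :=
      mul_le_mul_of_nonneg_left hrℓ (by linarith)
    linarith
  -- `rpow` algebra: `U^a L₃^a = (log x)^a`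
  have hU0 : 0 < lx / L₃ := div_pos hlx0 hL₃0
  have hUa : (lx / L₃) ^ ((k : ℝ) * (z.re - 1)) * L₃ ^ ((k : ℝ) * (z.re - 1)) =
      lx ^ ((k : ℝ) * (z.re - 1)) := by
    rw [← Real.mul_rpow hU0.le hL₃0.le, div_mul_cancel₀ _ hL₃0.ne']
  have hxa : 0 ≤ x * lx ^ ((k : ℝ) * (z.re - 1)) := mul_nonneg hx (Real.rpow_nonneg hlx0.le _)
  -- third term: `‖Σ c_q/d_q‖ ‖R‖`
  have hT₃ : ‖∑ q ∈ ι, c q / (q.1 : ℂ)‖ * ‖R‖ ≤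
      B₄ * B₆ * (x * lx ^ ((k : ℝ) * (z.re - 1))) * Real.exp (6 * P * (r * Real.sqrt r) + 4 * P) := by
    have h1 : ‖∑ q ∈ ι, c q / (q.1 : ℂ)‖ ≤
        B₄ * L₃ ^ ((k : ℝ) * (z.re - 1)) * Real.exp (C₄ * r * Real.log (r + 2)) :=
      hΛ.trans (by gcongr)
    have h2 : ‖R‖ ≤ B₆ * x * (lx / L₃) ^ ((k : ℝ) * (z.re - 1)) *
        Real.exp (C₆ * r * Real.log (r + 2)) :=
      h6.trans (by gcongr)
    calc ‖∑ q ∈ ι, c q / (q.1 : ℂ)‖ * ‖R‖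
        ≤ (B₄ * L₃ ^ ((k : ℝ) * (z.re - 1)) * Real.exp (C₄ * r * Real.log (r + 2))) *
            (B₆ * x * (lx / L₃) ^ ((k : ℝ) * (z.re - 1)) * Real.exp (C₆ * r * Real.log (r + 2))) :=
          mul_le_mul h1 h2 (norm_nonneg _) (by positivity)
      _ = B₄ * B₆ * (x * ((lx / L₃) ^ ((k : ℝ) * (z.re - 1)) * L₃ ^ ((k : ℝ) * (z.re - 1)))) *
            Real.exp (C₄ * r * Real.log (r + 2) + C₆ * r * Real.log (r + 2)) := by
          rw [Real.exp_add]; ring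
      _ ≤ B₄ * B₆ * (x * lx ^ ((k : ℝ) * (z.re - 1))) *
            Real.exp (6 * P * (r * Real.sqrt r) + 4 * P) := by
          rw [hUa]
          exact mul_le_mul_of_nonneg_left (Real.exp_le_exp.2 hE₃) (by positivity)
  -- second term: `Σ ‖c_q‖ ‖CS_q − R/d_q‖`
  have hT₂ : ∑ q ∈ ι, ‖c q‖ * ‖CS q - R / (q.1 : ℂ)‖ ≤
      (x * lx ^ ((k : ℝ) * (z.re - 1))) * Real.exp (6 * P * (r * Real.sqrt r) + 4 * P) := by
    have hW0 : 0 ≤ x * (lx / L₃) ^ ((k : ℝ) * (z.re - 1)) * Real.exp (C₅ * r * Real.log (r + 2)) *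
        lx ^ (-δ) := by positivity
    have h1 : ∑ q ∈ ι, ‖c q‖ * ‖CS q - R / (q.1 : ℂ)‖ ≤ (∑ q ∈ ι, ‖c q‖ / (q.1 : ℝ)) *
        (x * (lx / L₃) ^ ((k : ℝ) * (z.re - 1)) * Real.exp (C₅ * r * Real.log (r + 2)) *
          lx ^ (-δ)) := by
      rw [Finset.sum_mul]
      refine Finset.sum_le_sum fun q hq => ?_
      calc ‖c q‖ * ‖CS q - R / (q.1 : ℂ)‖
          ≤ ‖c q‖ * (x / (q.1 : ℝ) * (lx / L₃) ^ ((k : ℝ) * (z.re - 1)) *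
              Real.exp (C₅ * r * Real.log (r + 2)) * lx ^ (-δ)) :=
            mul_le_mul_of_nonneg_left (h5 q hq) (norm_nonneg _)
        _ = ‖c q‖ / (q.1 : ℝ) * (x * (lx / L₃) ^ ((k : ℝ) * (z.re - 1)) *
              Real.exp (C₅ * r * Real.log (r + 2)) * lx ^ (-δ)) := by
            ring
    have h3 : L₃ ^ ((k : ℝ) * (‖z‖ - 1)) =
        L₃ ^ ((k : ℝ) * (z.re - 1)) * L₃ ^ ((k : ℝ) * (‖z‖ - z.re)) := by
      rw [← Real.rpow_add hL₃0]; congr 1; ring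
    have h4 : L₃ ^ ((k : ℝ) * (‖z‖ - 1)) * Real.exp (C₄ * (‖z‖ + 1)) *
        (x * (lx / L₃) ^ ((k : ℝ) * (z.re - 1)) * Real.exp (C₅ * r * Real.log (r + 2)) *
          lx ^ (-δ)) =
        (x * lx ^ ((k : ℝ) * (z.re - 1))) *
          Real.exp (Real.log L₃ * ((k : ℝ) * (‖z‖ - z.re)) + C₄ * (‖z‖ + 1) +
            C₅ * r * Real.log (r + 2) + Real.log lx * (-δ)) := by
      rw [h3, Real.rpow_def_of_pos hL₃0 ((k : ℝ) * (‖z‖ - z.re)), Real.rpow_def_of_pos hlx0 (-δ),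
        Real.exp_add, Real.exp_add, Real.exp_add, ← hUa]
      ring
    calc ∑ q ∈ ι, ‖c q‖ * ‖CS q - R / (q.1 : ℂ)‖ ≤ _ := h1
      _ ≤ L₃ ^ ((k : ℝ) * (‖z‖ - 1)) * Real.exp (C₄ * (‖z‖ + 1)) *
          (x * (lx / L₃) ^ ((k : ℝ) * (z.re - 1)) * Real.exp (C₅ * r * Real.log (r + 2)) *
            lx ^ (-δ)) :=
          mul_le_mul_of_nonneg_right hB hW0
      _ = _ := h4
      _ ≤ (x * lx ^ ((k : ℝ) * (z.re - 1))) * Real.exp (6 * P * (r * Real.sqrt r) + 4 * P) :=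
          mul_le_mul_of_nonneg_left (Real.exp_le_exp.2 hE₂) hxa
  -- assemble
  have hexp : Real.exp (6 * P * (r * Real.sqrt r) + 4 * P) =
      Real.exp (6 * P * (r * Real.sqrt r)) * Real.exp (4 * P) := Real.exp_add _ _
  have h1e : 1 ≤ Real.exp (6 * P * (r * Real.sqrt r)) := Real.one_le_exp (by positivity)
  calc ‖S‖ ≤ _ := norm_le_resum ι c CS S R
    _ ≤ x * lx ^ ((k : ℝ) * (z.re - 1)) +
        B₄ * B₆ * (x * lx ^ ((k : ℝ) * (z.re - 1))) * Real.exp (6 * P * (r * Real.sqrt r) + 4 * P) +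
        (x * lx ^ ((k : ℝ) * (z.re - 1))) * Real.exp (6 * P * (r * Real.sqrt r) + 4 * P) :=
      add_le_add_three hE hT₃ hT₂
    _ = (x * lx ^ ((k : ℝ) * (z.re - 1))) *
        (1 + (1 + B₄ * B₆) * Real.exp (4 * P) * Real.exp (6 * P * (r * Real.sqrt r))) := by
      rw [hexp]; ring
    _ ≤ (x * lx ^ ((k : ℝ) * (z.re - 1))) * (Real.exp (6 * P * (r * Real.sqrt r)) +
        (1 + B₄ * B₆) * Real.exp (4 * P) * Real.exp (6 * P * (r * Real.sqrt r))) :=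
      mul_le_mul_of_nonneg_left (add_le_add_left h1e _) hxa
    _ = (1 + (1 + B₄ * B₆) * Real.exp (4 * P)) * x * lx ^ ((k : ℝ) * (z.re - 1)) *
        Real.exp (6 * P * (r * Real.sqrt r)) := by ring

/-! ### The registered stub -/

/-- **S7 `stub_majorant_of_smooth_rough`** — the resummation: S4 ∧ S5 ∧ S6 ⇒ `DiscMajorant`
(`‖S_x(z)‖ ≤ A x (log x)^{k(Re z−1)} e^{C‖z−1‖^{3/2}}` on `‖z−1‖ ≤ 3 log log x`, `x ≥ x₀(f)`).
Given `f`, take `m₀, A₄, C₄, x₄` from S4, then `δ, C₅, x₅` from S5 at `m₀` and `A₆, C₆, x₆` from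
S6 at `m₀`; with `P = 1 + C₄⁺ + C₅⁺ + C₆⁺` the constants are `C = 6P`,
`A = 1 + (1 + A₄⁺A₆⁺) e^{4P}`, `x₀ = max (x₄, x₅, x₆, ⌈exp exp (max e (96k³/δ)²)⌉)`; the estimate
is `majorant_core` (see the module docstring for the computation). -/
theorem stub_majorant_of_smooth_rough :
    (∀ (k : ℕ) (f : Fin k → Polynomial ℤ), Literature.NumberTheory.Sieve.IsBatemanHornSystem f →
      ∃ m₀ : ℕ, ∃ A C : ℝ, ∃ x₀ : ℕ, ∀ x : ℕ, x₀ ≤ x → ∀ z : ℂ, ‖z - 1‖ ≤ 3 * Real.log (Real.log (x : ℝ)) →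
        ∃ (ι : Finset (ℕ × ℕ)) (c : ℕ × ℕ → ℂ),
          (∀ q ∈ ι, 0 < q.1 ∧ q.1 ∣ (∏ p ∈ Nat.primesLE ⌊Real.log (Real.log (x : ℝ))⌋₊, p ^ 2)) ∧
          ‖(∑ n ∈ Finset.range (x + 1), (z : ℂ) ^ (∑ i, (((f i).eval (n : ℤ)).toNat.factorization.sum fun _ v => min v 2))) -
              ∑ q ∈ ι, c q * (∑ n ∈ (Finset.Ico m₀ (x + 1)).filter (fun n : ℕ => n ≡ q.2 [MOD q.1]), (z : ℂ) ^ (∑ i, (((f i).eval (n : ℤ)).toNat.factorization.sum fun p v => if Real.log (Real.log (x : ℝ)) < (p : ℝ) then min v 2 else 0)))‖ ≤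
            (x : ℝ) * (Real.log (x : ℝ)) ^ ((k : ℝ) * (z.re - 1)) ∧
          ‖∑ q ∈ ι, c q / (q.1 : ℂ)‖ ≤
            A * (Real.log (Real.log (Real.log (x : ℝ)))) ^ ((k : ℝ) * (z.re - 1)) * Real.exp (C * ‖(z : ℂ) - 1‖ * Real.log (‖(z : ℂ) - 1‖ + 2)) ∧
          ∑ q ∈ ι, ‖c q‖ / (q.1 : ℝ) ≤
            (Real.log (Real.log (Real.log (x : ℝ)))) ^ ((k : ℝ) * (‖z‖ - 1)) * Real.exp (C * (‖z‖ + 1))) →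
    (∀ (k : ℕ) (f : Fin k → Polynomial ℤ), Literature.NumberTheory.Sieve.IsBatemanHornSystem f →
      ∀ m₀ : ℕ, ∃ δ : ℝ, 0 < δ ∧ ∃ C : ℝ, ∃ x₀ : ℕ, ∀ x : ℕ, x₀ ≤ x → ∀ z : ℂ, ‖z - 1‖ ≤ 3 * Real.log (Real.log (x : ℝ)) →
        ∀ d a : ℕ, 0 < d → d ∣ (∏ p ∈ Nat.primesLE ⌊Real.log (Real.log (x : ℝ))⌋₊, p ^ 2) →
          ‖(∑ n ∈ (Finset.Ico m₀ (x + 1)).filter (fun n : ℕ => n ≡ a [MOD d]), (z : ℂ) ^ (∑ i, (((f i).eval (n : ℤ)).toNat.factorization.sum fun p v => if Real.log (Real.log (x : ℝ)) < (p : ℝ) then min v 2 else 0))) -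
              (∑ n ∈ Finset.Ico m₀ (x + 1), (z : ℂ) ^ (∑ i, (((f i).eval (n : ℤ)).toNat.factorization.sum fun p v => if Real.log (Real.log (x : ℝ)) < (p : ℝ) then min v 2 else 0))) / (d : ℂ)‖ ≤
            (x : ℝ) / (d : ℝ) * (Real.log (x : ℝ) / Real.log (Real.log (Real.log (x : ℝ)))) ^ ((k : ℝ) * (z.re - 1)) * Real.exp (C * ‖(z : ℂ) - 1‖ * Real.log (‖(z : ℂ) - 1‖ + 2)) *
              (Real.log (x : ℝ)) ^ (-δ)) →
    (∀ (k : ℕ) (f : Fin k → Polynomial ℤ), Literature.NumberTheory.Sieve.IsBatemanHornSystem f →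
      ∀ m₀ : ℕ, ∃ A C : ℝ, ∃ x₀ : ℕ, ∀ x : ℕ, x₀ ≤ x → ∀ z : ℂ, ‖z - 1‖ ≤ 3 * Real.log (Real.log (x : ℝ)) →
        ‖(∑ n ∈ Finset.Ico m₀ (x + 1), (z : ℂ) ^ (∑ i, (((f i).eval (n : ℤ)).toNat.factorization.sum fun p v => if Real.log (Real.log (x : ℝ)) < (p : ℝ) then min v 2 else 0)))‖ ≤
          A * (x : ℝ) * (Real.log (x : ℝ) / Real.log (Real.log (Real.log (x : ℝ)))) ^ ((k : ℝ) * (z.re - 1)) * Real.exp (C * ‖(z : ℂ) - 1‖ * Real.log (‖(z : ℂ) - 1‖ + 2))) →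
    ∀ (k : ℕ) (f : Fin k → Polynomial ℤ), Literature.NumberTheory.Sieve.IsBatemanHornSystem f →
      ∃ A C : ℝ, ∃ x₀ : ℕ, ∀ x : ℕ, x₀ ≤ x → ∀ z : ℂ, ‖z - 1‖ ≤ 3 * Real.log (Real.log (x : ℝ)) →
        ‖(∑ n ∈ Finset.range (x + 1), (z : ℂ) ^ (∑ i, (((f i).eval (n : ℤ)).toNat.factorization.sum fun _ v => min v 2)))‖ ≤
          A * (x : ℝ) * (Real.log (x : ℝ)) ^ ((k : ℝ) * ((z : ℂ).re - 1)) * Real.exp (C * ‖(z : ℂ) - 1‖ ^ (3 / 2 : ℝ)) := by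
  intro hS4 hS5 hS6 k f hf
  obtain ⟨m₀, A₄, C₄, x₄, H4⟩ := hS4 k f hf
  obtain ⟨δ, hδ, C₅, x₅, H5⟩ := hS5 k f hf m₀
  obtain ⟨A₆, C₆, x₆, H6⟩ := hS6 k f hf m₀
  set P : ℝ := 1 + max C₄ 0 + max C₅ 0 + max C₆ 0 with hP
  set T : ℝ := max (Real.exp 1) ((96 * (k : ℝ) ^ 3 / δ) ^ 2)
  refine ⟨1 + (1 + max A₄ 0 * max A₆ 0) * Real.exp (4 * P), 6 * P,
    max (max x₄ (max x₅ x₆)) ⌈Real.exp (Real.exp T)⌉₊, fun x hx z hz => ?_⟩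
  obtain ⟨hx', hxc⟩ := max_le_iff.1 hx
  obtain ⟨hx₄, hx''⟩ := max_le_iff.1 hx'
  obtain ⟨hx₅, hx₆⟩ := max_le_iff.1 hx''
  have hxT : Real.exp (Real.exp T) ≤ (x : ℝ) := (Nat.le_ceil _).trans (by exact_mod_cast hxc)
  have hx0 : (0 : ℝ) < x := (Real.exp_pos _).trans_le hxT
  have hlx : Real.exp T ≤ Real.log (x : ℝ) := (Real.le_log_iff_exp_le hx0).2 hxT
  have h₄ := le_max_left C₄ 0
  have h₄' := le_max_right C₄ 0
  have h₅ := le_max_left C₅ 0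
  have h₅' := le_max_right C₅ 0
  have h₆ := le_max_left C₆ 0
  have h₆' := le_max_right C₆ 0
  obtain ⟨ι, c, hmem, hE, hΛ, hB⟩ := H4 x hx₄ z hz
  exact majorant_core hδ (by linarith) (by linarith) (by linarith) (by linarith) (le_max_left A₄ 0)
    (le_max_left A₆ 0) (le_max_right A₄ 0) (le_max_right A₆ 0) hx0.le hE hΛ hB (H6 x hx₆ z hz)
    (fun q hq => H5 x hx₅ z hz q.1 q.2 (hmem q hq).1 (hmem q hq).2) hlx rfl

end Summit.Parity.BatemanHorn.Cruxes.SystemZeroRepulsion.SmoothRoughLatticeAcquisition
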